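import Summits.QuantumFields.GaugeBoot.DiagonalRPTorusPolyakovCover
import HarnessLib

/-!
# Pairs of columns of `(ℤ/L)³`: adjacency, common neighbours, covering cost (gauge-boot, task L3(π), 2/7)

HONEST FRAMING (cell `pub-gaugeboot`, page 1 of every file): the venture produces certified bounds
on lattice expectations at stated coupling, gauge group, dimension and torus size; NOT a mass gap,
NOT a continuum limit, NOT a string tension; NOT Yang–Mills-summit-bearing (barriers
`FixedCouplingUltralocality`, `PerturbativeInvisibility`). This module is combinatorial
bookkeeping for the structural NEGATIVE result `DiagonalRPTorusInnerHalfNegativeEvenSUN`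
(inner-half diagonal RP fails on even three-tori for `G ≅ SU(N)` at small coupling); it
discharges nothing by itself.

## Content (torus `(ℤ/L)³`, spectator direction `2`, columns `A, B ∈ (ℤ/L)²`)

* `unbump a A` — one step back (`bump a (unbump a A) = A`); `Adj P Q` — nearest-neighbour columns;
  `adj_iff` — in coordinates: the difference `Q - P` is `±e₀` or `±e₁` (`L ≥ 2`);
* `eq_or_adj_of_pcnt_ne_zero` — a plaquette containing vertical links over `A` and over `B`
  forces `A = B` or `Adj A B` (and equal heights, `DiagRPSUN.height_eq_of_pcnt_ne_zero`);
* `Sep A B` — both coordinate differences avoid `{0, 1, -1}`; then `A ≠ B`, `¬ Adj A B` and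
  `A`, `B` have NO common neighbour (`not_adj_adj_of_sep`);
* the pair `(B + 2e_a, B)`: `bump_bump_ne_self`, `not_adj_bump_bump` and
  **`eq_bump_of_adj_adj`** — its ONLY common neighbour is `B + e_a` (`L ≥ 5`);
* **`two_mul_le_card_of_covers_of_not_adj`** — covering two distinct non-adjacent columns costs
  `2L` plaquettes (the `2L` column links lie in pairwise distinct plaquettes).

Elementary; no named fact.
-/

open Finset Function

namespace Summit.QuantumFields.GaugeBoot

open Literature.MathematicalPhysics.QuantumFieldTheory

noncomputable section

namespace DiagRPSUN

open DiagRPThree DiagRPPolyakov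

section Columns

variable {L : ℕ}

/-! ## Small residues -/

/-- `k ≢ 0 (mod L)` for `1 ≤ k < L`. -/
theorem natCast_ne_zero_of_lt {k : ℕ} (hk : 1 ≤ k) (hkL : k < L) : ((k : ℕ) : ZMod L) ≠ 0 := by
  intro h
  rw [ZMod.natCast_eq_zero_iff] at h
  have := Nat.le_of_dvd (by omega) h
  omega

/-- The residues `1, 2, 3, 4` are non-zero in `ℤ/L` for `L ≥ 5`. -/
theorem small_residues_ne_zero (hL : 5 ≤ L) :
    (1 : ZMod L) ≠ 0 ∧ (2 : ZMod L) ≠ 0 ∧ (3 : ZMod L) ≠ 0 ∧ (4 : ZMod L) ≠ 0 := by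
  refine ⟨?_, ?_, ?_, ?_⟩
  · exact_mod_cast natCast_ne_zero_of_lt (L := L) (k := 1) le_rfl (by omega)
  · exact_mod_cast natCast_ne_zero_of_lt (L := L) (k := 2) (by norm_num) (by omega)
  · exact_mod_cast natCast_ne_zero_of_lt (L := L) (k := 3) (by norm_num) (by omega)
  · exact_mod_cast natCast_ne_zero_of_lt (L := L) (k := 4) (by norm_num) (by omega)

/-! ## Adjacent columns -/

/-- The column one step BACK in the horizontal direction `a` (`a = 2`: no move). -/
def unbump (a : Fin 3) (A : ZMod L × ZMod L) : ZMod L × ZMod L :=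
  (A.1 - if a = 0 then 1 else 0, A.2 - if a = 1 then 1 else 0)

/-- `bump a (unbump a A) = A`. -/
@[simp] theorem bump_unbump (a : Fin 3) (A : ZMod L × ZMod L) : bump a (unbump a A) = A := by
  unfold bump unbump
  ext <;> simp

/-- `unbump a (bump a A) = A`. -/
@[simp] theorem unbump_bump (a : Fin 3) (A : ZMod L × ZMod L) : unbump a (bump a A) = A := by
  unfold bump unbump
  ext <;> simp

/-- ADJACENT columns: nearest neighbours of the square lattice `(ℤ/L)²`.
[shape] A parametric definition of a predicate — NOT a fact. [folklore] -/
def Adj (P Q : ZMod L × ZMod L) : Prop := ∃ a : Fin 3, a ≠ 2 ∧ (Q = bump a P ∨ P = bump a Q)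

/-- Adjacency is symmetric. -/
theorem Adj.symm {P Q : ZMod L × ZMod L} (h : Adj P Q) : Adj Q P := by
  obtain ⟨a, ha, h⟩ := h
  exact ⟨a, ha, h.symm⟩

/-- A horizontal direction is `0` or `1`. -/
theorem eq_zero_or_one_of_ne_two {a : Fin 3} (ha : a ≠ 2) : a = 0 ∨ a = 1 := by
  fin_cases a
  · exact Or.inl rfl
  · exact Or.inr rfl
  · exact absurd rfl ha

/-- **Adjacency in coordinates**: `Q - P ∈ {e₀, e₁, -e₀, -e₁}`. -/
theorem adj_iff {P Q : ZMod L × ZMod L} : Adj P Q ↔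
    (Q.1 - P.1 = 1 ∧ Q.2 - P.2 = 0) ∨ (Q.1 - P.1 = 0 ∧ Q.2 - P.2 = 1) ∨
      (Q.1 - P.1 = -1 ∧ Q.2 - P.2 = 0) ∨ (Q.1 - P.1 = 0 ∧ Q.2 - P.2 = -1) := by
  constructor
  · rintro ⟨a, ha, h | h⟩
    · rcases eq_zero_or_one_of_ne_two ha with rfl | rfl
      · left; rw [h]; simp [bump]
      · right; left; rw [h]; simp [bump]
    · rcases eq_zero_or_one_of_ne_two ha with rfl | rfl
      · right; right; left; rw [h]; simp [bump]
      · right; right; right; rw [h]; simp [bump]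
  · rintro (⟨h1, h2⟩ | ⟨h1, h2⟩ | ⟨h1, h2⟩ | ⟨h1, h2⟩)
    · refine ⟨0, by decide, Or.inl (Prod.ext ?_ ?_)⟩ <;> simp [bump]
      · linear_combination h1
      · linear_combination h2
    · refine ⟨1, by decide, Or.inl (Prod.ext ?_ ?_)⟩ <;> simp [bump]
      · linear_combination h1
      · linear_combination h2
    · refine ⟨0, by decide, Or.inr (Prod.ext ?_ ?_)⟩ <;> simp [bump]
      · linear_combination -h1
      · linear_combination -h2
    · refine ⟨1, by decide, Or.inr (Prod.ext ?_ ?_)⟩ <;> simp [bump]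
      · linear_combination -h1
      · linear_combination -h2

/-- The coordinate differences of adjacent columns lie in `{0, 1, -1}`. -/
theorem diff_cases_of_adj {P Q : ZMod L × ZMod L} (h : Adj P Q) :
    (Q.1 - P.1 = 0 ∨ Q.1 - P.1 = 1 ∨ Q.1 - P.1 = -1) ∧
      (Q.2 - P.2 = 0 ∨ Q.2 - P.2 = 1 ∨ Q.2 - P.2 = -1) ∧ (Q.1 - P.1 = 0 ∨ Q.2 - P.2 = 0) := by
  rcases adj_iff.1 h with ⟨h1, h2⟩ | ⟨h1, h2⟩ | ⟨h1, h2⟩ | ⟨h1, h2⟩ <;> simp [h1, h2]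

/-! ## Plaquettes through two columns -/

/-- **A plaquette containing vertical links over `A` and over `B` forces `A = B` or `Adj A B`.** -/
theorem eq_or_adj_of_pcnt_ne_zero {p : Plaquette 3 L} {A B : ZMod L × ZMod L} {z w : ZMod L}
    (hA : pcnt p (vsite A z, 2) ≠ 0) (hB : pcnt p (vsite B w, 2) ≠ 0) : A = B ∨ Adj A B := by
  have hi := plaq_fst_ne_two p
  have hzw : z = w := (height_eq_of_pcnt_ne_zero hA).symm.trans (height_eq_of_pcnt_ne_zero hB)
  subst hzw
  obtain ⟨-, hAy⟩ := vertical_of_pcnt_ne_zero hA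
  obtain ⟨-, hBy⟩ := vertical_of_pcnt_ne_zero hB
  rcases hAy with hAy | hAy <;> rcases hBy with hBy | hBy
  · exact Or.inl (vsite_eq_vsite_iff.1 (hAy.trans hBy.symm)).1
  · -- `A` over `x + e_i`, `B` over `x`: `A = bump i B`
    right
    refine ⟨p.2.1.1, hi, Or.inr ?_⟩
    have h := hAy
    rw [← hBy, vsite_shift_of_ne_two B z hi] at h
    exact (vsite_eq_vsite_iff.1 h).1
  · right
    refine ⟨p.2.1.1, hi, Or.inl ?_⟩
    have h := hBy
    rw [← hAy, vsite_shift_of_ne_two A z hi] at h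
    exact (vsite_eq_vsite_iff.1 h).1
  · exact Or.inl (vsite_eq_vsite_iff.1 (hAy.trans hBy.symm)).1

/-! ## Separated pairs: no common neighbour -/

/-- SEPARATED columns: both coordinate differences avoid `{0, 1, -1}`.
[shape] A parametric definition of a predicate — NOT a fact. [folklore] -/
def Sep (A B : ZMod L × ZMod L) : Prop :=
  (A.1 - B.1 ≠ 0 ∧ A.1 - B.1 ≠ 1 ∧ A.1 - B.1 ≠ -1) ∧ (A.2 - B.2 ≠ 0 ∧ A.2 - B.2 ≠ 1 ∧ A.2 - B.2 ≠ -1)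

/-- Separated columns are distinct. -/
theorem ne_of_sep {A B : ZMod L × ZMod L} (h : Sep A B) : A ≠ B := fun hAB =>
  h.1.1 (by rw [hAB, sub_self])

/-- Separated columns are not adjacent. -/
theorem not_adj_of_sep {A B : ZMod L × ZMod L} (h : Sep A B) : ¬ Adj A B := fun hadj => by
  obtain ⟨-, -, h0 | h0⟩ := diff_cases_of_adj hadj
  · exact h.1.1 (by linear_combination -h0)
  · exact h.2.1 (by linear_combination -h0)

/-- **Separated columns have no common neighbour.** -/
theorem not_adj_adj_of_sep {A B : ZMod L × ZMod L} (h : Sep A B) (O : ZMod L × ZMod L)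
    (hAO : Adj A O) (hOB : Adj O B) : False := by
  obtain ⟨h1, h2, h0⟩ := diff_cases_of_adj hAO
  obtain ⟨k1, k2, k0⟩ := diff_cases_of_adj hOB
  obtain ⟨⟨a0, a1, am⟩, ⟨b0, b1, bm⟩⟩ := h
  -- one of the two steps is horizontal-free or vertical-free
  rcases h0 with h0 | h0 <;> rcases k0 with k0 | k0
  · -- both steps vertical: first coordinates agree
    exact a0 (by linear_combination -h0 - k0)
  · -- first step vertical (`O.1 = A.1`), second horizontal (`B.2 = O.2`)
    rcases k1 with k1 | k1 | k1
    · exact a0 (by linear_combination -h0 - k1)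
    · exact am (by linear_combination -h0 - k1)
    · exact a1 (by linear_combination -h0 - k1)
  · rcases h1 with h1 | h1 | h1
    · exact a0 (by linear_combination -h1 - k0)
    · exact am (by linear_combination -h1 - k0)
    · exact a1 (by linear_combination -h1 - k0)
  · -- both steps horizontal: second coordinates agree
    exact b0 (by linear_combination -h0 - k0)

/-! ## The pair `(B + 2e_a, B)` -/

/-- `B + 2e_a ≠ B` (`L ≥ 3`). -/
theorem bump_bump_ne_self (hL : 3 ≤ L) {a : Fin 3} (ha : a ≠ 2) (B : ZMod L × ZMod L) :
    bump a (bump a B) ≠ B :=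
  bump_bump_ne hL ha ha B

/-- `bump 0` in coordinates. -/
theorem bump_zero (A : ZMod L × ZMod L) : bump 0 A = (A.1 + 1, A.2) := by
  unfold bump
  rw [if_pos rfl, if_neg (by decide), add_zero]

/-- `bump 1` in coordinates. -/
theorem bump_one (A : ZMod L × ZMod L) : bump 1 A = (A.1, A.2 + 1) := by
  unfold bump
  rw [if_neg (by decide), if_pos rfl, add_zero]

/-- `B + 2e_a` is not adjacent to `B` (`L ≥ 5`). -/
theorem not_adj_bump_bump (hL : 5 ≤ L) {a : Fin 3} (ha : a ≠ 2) (B : ZMod L × ZMod L) :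
    ¬ Adj (bump a (bump a B)) B := by
  obtain ⟨h1, h2, h3, -⟩ := small_residues_ne_zero hL
  intro h
  rcases eq_zero_or_one_of_ne_two ha with rfl | rfl
  · rw [bump_zero, bump_zero] at h
    obtain ⟨d1, -, -⟩ := diff_cases_of_adj h
    dsimp only at d1
    rcases d1 with d | d | d
    · exact h2 (by linear_combination -d)
    · exact h3 (by linear_combination -d)
    · exact h1 (by linear_combination -d)
  · rw [bump_one, bump_one] at h
    obtain ⟨-, d2, -⟩ := diff_cases_of_adj h
    dsimp only at d2
    rcases d2 with d | d | d
    · exact h2 (by linear_combination -d)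
    · exact h3 (by linear_combination -d)
    · exact h1 (by linear_combination -d)

/-- **The only common neighbour of `B + 2e_a` and `B` is `B + e_a`** (`L ≥ 5`). -/
theorem eq_bump_of_adj_adj (hL : 5 ≤ L) {a : Fin 3} (ha : a ≠ 2) {B O : ZMod L × ZMod L}
    (hAO : Adj (bump a (bump a B)) O) (hOB : Adj O B) : O = bump a B := by
  obtain ⟨h1, h2, h3, h4⟩ := small_residues_ne_zero hL
  obtain ⟨q1, q2, q0⟩ := diff_cases_of_adj hOB
  rcases eq_zero_or_one_of_ne_two ha with rfl | rfl
  · rw [bump_zero, bump_zero] at hAO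
    rw [bump_zero]
    obtain ⟨p1, -, -⟩ := diff_cases_of_adj hAO
    dsimp only at p1
    -- first coordinate: `O.1 - B.1 - 2 ∈ {0,1,-1}` and `B.1 - O.1 ∈ {0,1,-1}` force `O.1 = B.1 + 1`
    have d1 : O.1 = B.1 + 1 := by
      rcases p1 with p | p | p <;> rcases q1 with q | q | q
      · exact absurd (by linear_combination -p - q) h2
      · exact absurd (by linear_combination -p - q) h3
      · exact absurd (by linear_combination -p - q) h1
      · exact absurd (by linear_combination -p - q) h3
      · exact absurd (by linear_combination -p - q) h4
      · exact absurd (by linear_combination -p - q) h2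
      · exact absurd (by linear_combination -p - q) h1
      · exact absurd (by linear_combination -p - q) h2
      · linear_combination p
    have d2 : O.2 = B.2 := by
      rcases q0 with q | q
      · exact absurd (by linear_combination -q - d1) h1
      · linear_combination -q
    exact Prod.ext d1 d2
  · rw [bump_one, bump_one] at hAO
    rw [bump_one]
    obtain ⟨-, p2, -⟩ := diff_cases_of_adj hAO
    dsimp only at p2
    have d2 : O.2 = B.2 + 1 := by
      rcases p2 with p | p | p <;> rcases q2 with q | q | q
      · exact absurd (by linear_combination -p - q) h2
      · exact absurd (by linear_combination -p - q) h3
      · exact absurd (by linear_combination -p - q) h1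
      · exact absurd (by linear_combination -p - q) h3
      · exact absurd (by linear_combination -p - q) h4
      · exact absurd (by linear_combination -p - q) h2
      · exact absurd (by linear_combination -p - q) h1
      · exact absurd (by linear_combination -p - q) h2
      · linear_combination p
    have d1 : O.1 = B.1 := by
      rcases q0 with q | q
      · linear_combination -q
      · exact absurd (by linear_combination -q - d2) h1
    exact Prod.ext d1 d2

/-! ## Covering two non-adjacent columns -/

variable [NeZero L]

/-- **Covering two distinct non-adjacent columns costs `2L` plaquettes**: the `2L` column links
lie in pairwise distinct plaquettes of `S`. -/
theorem two_mul_le_card_of_covers_of_not_adj {S : Finset (Plaquette 3 L)} {A B : ZMod L × ZMod L}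
    (hAB : A ≠ B) (hn : ¬ Adj A B) (hA : Covers S A) (hB : Covers S B) : 2 * L ≤ S.card := by
  classical
  choose fA hfAS hfA using hA
  choose fB hfBS hfB using hB
  set g : ZMod L ⊕ ZMod L → Plaquette 3 L := Sum.elim fA fB with hg
  have hinj : Function.Injective g := by
    rintro (z | z) (w | w) h
    · simp only [hg, Sum.elim_inl] at h
      have hz := height_eq_of_pcnt_ne_zero (hfA z)
      rw [h] at hz
      rw [hz.symm.trans (height_eq_of_pcnt_ne_zero (hfA w))]
    · simp only [hg, Sum.elim_inl, Sum.elim_inr] at h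
      have := eq_or_adj_of_pcnt_ne_zero (hfA z) (h ▸ hfB w)
      exact absurd this (not_or.2 ⟨hAB, hn⟩)
    · simp only [hg, Sum.elim_inl, Sum.elim_inr] at h
      have := eq_or_adj_of_pcnt_ne_zero (hfA w) (h.symm ▸ hfB z)
      exact absurd this (not_or.2 ⟨hAB, hn⟩)
    · simp only [hg, Sum.elim_inr] at h
      have hz := height_eq_of_pcnt_ne_zero (hfB z)
      rw [h] at hz
      rw [hz.symm.trans (height_eq_of_pcnt_ne_zero (hfB w))]
  have hsub : univ.image g ⊆ S := by
    rintro p hp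
    obtain ⟨x, -, rfl⟩ := mem_image.1 hp
    rcases x with z | z
    · exact hfAS z
    · exact hfBS z
  calc 2 * L = (univ.image g).card := by
        rw [card_image_of_injective _ hinj, card_univ, Fintype.card_sum, ZMod.card]; ring
    _ ≤ S.card := card_le_card hsub

end Columns

end DiagRPSUN

end

end Summit.QuantumFields.GaugeBoot
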